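import Summits.QuantumFields.Balaban3D.Carriers.StepSeries
import HarnessLib

/-!
# (α)-row LOCATE sweep, door (G3): the R-ACT ∕ G3D-02 PAIR {`hact`, `hG`} of the d = 3 lane's (α) package is, for the definer,
# ONE carrier-free printed identity (24)∘(58)–(59) plus (25) pointwise — kernel certificate of px17 g11's LOCATE
# `LOCATE-ALPHA-rows1-5-hact-px17g11.md` (19936 evidence #47)

Cell `ym3-torus`, seat `ym3-torus-px17` g11 (★★OWNER g35's (α)-ROW LOCATE SWEEP, rows #14 `hact` ∕ #15 `hG` of
`AlphaInputsT3ACv3LaneCore.StepAlphaV3CoreAC` = `Balaban3D.Proofs.AlphaAC.StepAlphaAC`'s texts).  `--supports stmt-QuantumFields-19936` (helper).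
Sorry-free; standard axioms; theorems only; nothing in the lane is touched.

THE LOCATED POINT.  Row #14 `hact : ∀ h Y U, ((𝔖 k).Gt h).activities.act Y U = (𝔖 k).act h Y U` (R-ACT) ties the two independent primitive
fields `Gt` (the G3D-02 graph carrier, `Binders.GraphTerms`) and `Ψ` (the charts; `StepSeries.act h X U := Re Ψ_X(B_X(h,U))`, R-29) of
`Carriers.StepSeries`; row #15 `hG : ∀ h, GraphRep23AsCited ((𝔖 k).Gt h) (fun U => Σ_{n ≤ n̄} c h U n ∕ n!) C₂₃ c₂₃ M₁ δ₀` (G3D-02) says the carrier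
represents the cumulant sum.  The leaves C3∕C4 (`LeavesCumAC.cumulant58∕cumulantLower_piecesAC` → `Run3Cumulant.cumulant58_of_graphRep23'` ∕
`Cumulant59.cumulantLower_torus`) read the pair in exactly ONE way: `(hG h).cum_eq_sum_activities ∘ hact`, i.e. as the carrier-free identity
`Σ_{n ∈ Icc 1 n̄} c h U n ∕ n! = Σ_{X} (𝔖 k).act h X U` — [Balaban1985UV3] (24) p. 262 «Summing the expressions with the same localization X …»
∘ (58)–(59) p. 270 «We calculate the last integral using the cumulant expansion formula again up to sixth order in g_k … we get
Σ_X 𝒫′_{k+1}(g_k, X, U_{k+1})» — which is VERBATIM the hypothesis of `Cumulant59.cumulant58_torus` ∕ `cumulantLower_torus`; clauses (ii)–(iv)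
of `GraphRep23AsCited` ((23) per expression, ≤ 6 vertices) have no reader in the lane ((25) for `act` is the theorem
`bound25_act_of_le_core` of rows `chart` + `bound28`).
* §1 `sum_eq_sum_act_of_graphRep23` — PAIR ⇒ IDENTITY (generic over a localization system `D`, a history type `H`, configurations `Cfg`);
  `sum_cum_eq_sum_act_of_rows` — the same at the lane's `Carriers.StepSeries` objects, concluding the hypothesis of `cumulant58_torus` verbatim.
* §2 `exists_graphTerms_of_sum_eq_sum_act` — IDENTITY + (25) POINTWISE ⇒ PAIR: the one-expression-per-localization carrier
  (`Γ := D.Dom`, `E X := a h X`, `loc := id`, one vertex, no lines, `pref := rate`) has `activities.act = a h` and satisfies `GraphRep23AsCited`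
  at the identity's left side for ANY walk constants `(C, c, M₁, δ₀)`; `exists_graphTerms_of_bound25` — the same with (25) in LQB's shape
  `B10.Bound25Printed ⟨D.Dom, Cfg, D.dj, a h⟩ g κ C`; `exists_Gt_of_rows_act` — at the lane's objects: from the identity at `(𝔖 k).act` and (25)
  for `(𝔖 k).act`, a carrier `Gt` with rows #14 and #15 — what the B0 DEFINER may take for the `Gt` field.
HONEST SCOPE.  Bookkeeping about hypothesis shapes; nothing asserted about Bałaban's expansion ((23)'s walk structure is NOT constructed — pub-balaban
GAPS G-IF-04); (α) data rows 0∕23 unchanged; rung R3 = SU(2) YM₃ on T³ — NOT d = 4, NOT infinite volume, NOT a mass gap, NOT Clay.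
References: [Balaban1985UV3] T. Bałaban, CMP 102 (1985) 255–275 — (23)–(25) p. 262, (29) p. 263, (58)–(59) p. 270.
-/

set_option autoImplicit false

noncomputable section

namespace Summit.QuantumFields.YangMills.Theorems.AlphaInputsT3ACGraphPairOfIdentity

open Finset
open scoped BigOperators Nat
open Literature.MathematicalPhysics.QuantumFieldTheory.Balaban1983to89
open Literature.MathematicalPhysics.QuantumFieldTheory.Balaban1983to89.B10
open Literature.MathematicalPhysics.QuantumFieldTheory.Balaban1983to89.TreeLengthTorus (tsys)
open Literature.MathematicalPhysics.QuantumFieldTheory.Balaban1985CMP102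
open Literature.MathematicalPhysics.QuantumFieldTheory.Balaban1985CMP102.Setting
open Literature.MathematicalPhysics.QuantumFieldTheory.Balaban1985CMP102.Binders (GraphTerms GraphRep23AsCited)
open Summit.QuantumFields.Balaban3D.Carriers

/-! ## §1 PAIR ⇒ IDENTITY (all that the leaves C3∕C4 read) -/

section Generic

variable {D : LocDomainSys} [DecidableEq D.Dom] {Cfg H : Type}

/-- **Rows `hG` (G3D-02) and `hact` (R-ACT) together say exactly `s h U = Σ_X a h X U`** — the carrier-free identity the leaves consume
(`Run3Cumulant.cumulant58_of_graphRep23'` passes precisely this composition to `Cumulant59.cumulant58_torus`). [cite: Balaban1985UV3, (24) p.262 + (58)–(59) p.270] -/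
theorem sum_eq_sum_act_of_graphRep23 {Gt : H → GraphTerms D Cfg} {s : H → Cfg → ℝ} {C c M₁ δ₀ : ℝ}
    {a : H → D.Dom → Cfg → ℝ} (hG : ∀ h, GraphRep23AsCited (Gt h) (s h) C c M₁ δ₀)
    (hact : ∀ h X U, (Gt h).activities.act X U = a h X U) (h : H) (U : Cfg) :
    s h U = ∑ X : D.Dom, a h X U := by
  rw [(hG h).cum_eq_sum_activities U]
  exact Finset.sum_congr rfl fun X _ => hact h X U

/-! ## §2 IDENTITY + (25) POINTWISE ⇒ PAIR (the one-expression-per-localization carrier) -/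

/-- **The one-expression-per-localization carrier realises the pair from the identity**: given `s h U = Σ_X a h X U`, a nonnegative
rate `p h X` and the pointwise bound `|a h X U| ≤ p h X`, the graph carrier with ONE expression per localization `X` (value `a h X`,
one vertex, no lines, prefactor `p h X`) has activities `a h` and satisfies `GraphRep23AsCited` at `s h` for ANY walk constants
`(C, c, M₁, δ₀)` (empty line products). Bookkeeping. [cite: Balaban1985UV3, (23)–(24) p.262] -/
theorem exists_graphTerms_of_sum_eq_sum_act {s : H → Cfg → ℝ} {a : H → D.Dom → Cfg → ℝ} {p : H → D.Dom → ℝ}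
    (hs : ∀ h U, s h U = ∑ X : D.Dom, a h X U) (hp : ∀ h X, 0 ≤ p h X) (hap : ∀ h X U, |a h X U| ≤ p h X)
    (C c M₁ δ₀ : ℝ) :
    ∃ Gt : H → GraphTerms D Cfg,
      (∀ h X U, (Gt h).activities.act X U = a h X U) ∧ ∀ h, GraphRep23AsCited (Gt h) (s h) C c M₁ δ₀ := by
  let Gt : H → GraphTerms D Cfg := fun h =>
    { Γ := D.Dom
      supp := Finset.univ
      E := fun X U => a h X U
      loc := id
      nv := fun _ => 1
      pref := p h
      lines := fun _ => [] }
  refine ⟨Gt, fun h X U => ?_, fun h => ⟨fun U => ?_, fun γ _ => ⟨by norm_num [Gt], by simp [Gt]⟩,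
    fun γ _ => hp h γ, fun γ _ U => ?_⟩⟩
  · show ∑ γ ∈ Finset.univ.filter (fun γ : D.Dom => id γ = X), a h γ U = a h X U
    exact Finset.sum_eq_single_of_mem (X : D.Dom) (Finset.mem_filter.mpr ⟨Finset.mem_univ (α := D.Dom) X, rfl⟩)
      fun γ hγ hne => absurd (Finset.mem_filter.mp hγ).2 hne
  · show s h U = ∑ γ ∈ Finset.univ, a h γ U
    exact hs h U
  · show |a h γ U| ≤ p h γ * (([] : List (ℕ × ℝ)).map fun l => B9.walkFactor C c M₁ δ₀ l.1 l.2).prod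
    simpa using hap h γ U

/-- **The same with (25) in LQB's printed shape** `B10.Bound25Printed ⟨D.Dom, Cfg, D.dj, a h⟩ g κ C₂₅` (rate `C₂₅·g·e^{−κ d_j(X)}`, `0 ≤ C₂₅·g`).
[cite: Balaban1985UV3, (23)–(25) p.262] -/
theorem exists_graphTerms_of_bound25 {s : H → Cfg → ℝ} {a : H → D.Dom → Cfg → ℝ}
    (hs : ∀ h U, s h U = ∑ X : D.Dom, a h X U) {g κ C₂₅ : ℝ} (hCg : 0 ≤ C₂₅ * g)
    (h25 : ∀ h, Bound25Printed ⟨D.Dom, Cfg, D.dj, a h⟩ g κ C₂₅) (C c M₁ δ₀ : ℝ) :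
    ∃ Gt : H → GraphTerms D Cfg,
      (∀ h X U, (Gt h).activities.act X U = a h X U) ∧ ∀ h, GraphRep23AsCited (Gt h) (s h) C c M₁ δ₀ :=
  exists_graphTerms_of_sum_eq_sum_act hs (p := fun _ X => C₂₅ * g * Real.exp (-(κ * D.dj X)))
    (fun _ _ => mul_nonneg hCg (Real.exp_nonneg _)) (fun h X U => h25 h X U) C c M₁ δ₀

end Generic

/-! ## §3 At the lane's objects (`Carriers.StepSeries`) -/

section Lane

variable {L : ℕ} {S : Scales L} {G : Type} [GaugeGroup G] [MeasurableSpace G] [HaarData G]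
  {V : Type} [NormedAddCommGroup V] [NormedSpace ℂ V] {N : ℕ} [NeZero N] {k : ℕ}

/-- **Rows #15 `hG` + #14 `hact` of the (α) package ⇒ the hypothesis of `Cumulant59.cumulant58_torus` ∕ `cumulantLower_torus` VERBATIM**:
`Σ_{n ∈ Icc 1 n̄} c h U n ∕ n! = Σ_X (𝔖).act h X U` — (24) ∘ (58)–(59). [cite: Balaban1985UV3, (24) p.262 + (58)–(59) p.270] -/
theorem sum_cum_eq_sum_act_of_rows (𝔖 : StepSeries S G V N k) [DecidableEq (tsys 3 N).Dom]
    {c : Hist S.P (k + 1) → GaugeField S.P (k + 1) G → ℕ → ℝ} {nbar : ℕ} {C₂₃ c₂₃ M₁ δ₀ : ℝ}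
    (hG : ∀ h, GraphRep23AsCited (𝔖.Gt h) (fun U => ∑ n ∈ Finset.Icc 1 nbar, c h U n / (n ! : ℝ)) C₂₃ c₂₃ M₁ δ₀)
    (hact : ∀ h X U, (𝔖.Gt h).activities.act X U = 𝔖.act h X U)
    (h : Hist S.P (k + 1)) (U : GaugeField S.P (k + 1) G) :
    ∑ n ∈ Finset.Icc 1 nbar, c h U n / (n ! : ℝ) = ∑ X : (tsys 3 N).Dom, 𝔖.act h X U :=
  sum_eq_sum_act_of_graphRep23 (s := fun h U => ∑ n ∈ Finset.Icc 1 nbar, c h U n / (n ! : ℝ)) hG hact h U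

/-- **What the B0 DEFINER may take for the `Gt` field**: from the printed identity at the chart activities `(𝔖).act` and (25) for them
(a theorem of rows `chart` + `bound28`: `AlphaInputsT3ACv3LaneCore.bound25_act_of_le_core`), a graph carrier satisfying rows #14 `hact` and
#15 `hG` with any walk constants. [cite: Balaban1985UV3, (23)–(25) p.262 + (58)–(59) p.270] -/
theorem exists_Gt_of_rows_act (𝔖 : StepSeries S G V N k) [DecidableEq (tsys 3 N).Dom]
    {c : Hist S.P (k + 1) → GaugeField S.P (k + 1) G → ℕ → ℝ} {nbar : ℕ}
    (h2459 : ∀ h U, ∑ n ∈ Finset.Icc 1 nbar, c h U n / (n ! : ℝ) = ∑ X : (tsys 3 N).Dom, 𝔖.act h X U)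
    {g κ C₂₅ : ℝ} (hCg : 0 ≤ C₂₅ * g)
    (h25 : ∀ h, Bound25Printed ⟨(tsys 3 N).Dom, GaugeField S.P (k + 1) G, (tsys 3 N).dj, 𝔖.act h⟩ g κ C₂₅)
    (C₂₃ c₂₃ M₁ δ₀ : ℝ) :
    ∃ Gt : Hist S.P (k + 1) → GraphTerms (tsys 3 N) (GaugeField S.P (k + 1) G),
      (∀ h X U, (Gt h).activities.act X U = 𝔖.act h X U) ∧
      ∀ h, GraphRep23AsCited (Gt h) (fun U => ∑ n ∈ Finset.Icc 1 nbar, c h U n / (n ! : ℝ)) C₂₃ c₂₃ M₁ δ₀ :=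
  exists_graphTerms_of_bound25 (s := fun h U => ∑ n ∈ Finset.Icc 1 nbar, c h U n / (n ! : ℝ)) h2459 hCg h25 C₂₃ c₂₃ M₁ δ₀

end Lane

end Summit.QuantumFields.YangMills.Theorems.AlphaInputsT3ACGraphPairOfIdentity

end
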